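import Summits.QuantumFields.YangMills.Theorems.IR.SCFloorTorusCov
import Summits.QuantumFields.YangMills.Theorems.IR.SCFloorOffDiagGeometry

/-!
# Strong-coupling floor engine, part 14: a NON-facing pair of plaquettes in adjacent time slices has covariance `O(b⁵)`

Pooled prover `ym-ir-line-bsf-p1` (crux `IR`, stmt-QuantumFields-19354), support for the consumer rung R2 of line
`momentum-pincer` (`NoLightMoversSCTransfer`): the off-diagonal terms of the slice sum `s(1)`.  On the torus
`(ℤ/L)⁴`, `L ≥ 3`, let `P = (a; 1,2)`, `P' = (a'; 1,2)` with `a' 0 = a 0 + 1` and `a' ≠ a + e₀`.  Then for `|b| ≤ b₁`: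
`|Cov_{wilsonMeasure ρ b}(Re tr ρ(U_P), Re tr ρ(U_{P'}))| ≤ K |b|⁵` (`torus_cov_offdiag_estimate`).  Same pipeline as
parts 8–9 (centring, doubling `BetaSlopeFloor.covariance_wilsonMeasure_eq_doubled`, symmetrisation, Mayer expansion,
antisymmetric-pair peeling), but now NO polymer of order `≤ 4` survives (part 13, `no_short_covering_offdiag`), so
there is no `b⁴` term (`mayer_sum_offdiag`).  The constants depend on the torus; volume-uniformity comes in part 15 by
the Schwarz-lemma transfer of part 10.  HONEST: strong coupling only; nothing here bears on the Yang–Mills mass gap.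
-/

set_option autoImplicit false

noncomputable section

open MeasureTheory Filter Topology Function Finset
open Literature.MathematicalPhysics.QuantumFieldTheory
open Literature.MathematicalPhysics.QuantumLattice (haarConv)

namespace Summit.QuantumFields.YangMills.Cruxes.IR.SCFloor

open BetaSlopeFloor (dTerm measurable_dTerm exists_bound_plaquetteCost measurable_inl_copy measurable_inr_copy
  covariance_wilsonMeasure_eq_doubled partition_pos)

variable {L : ℕ} [NeZero L] [Fact (1 < L)] {G : Type} [Group G] [TopologicalSpace G] [IsTopologicalGroup G]
  [CompactSpace G] [MeasurableSpace G] [BorelSpace G] [SecondCountableTopology G] [T2Space G]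
  {N : ℕ} (ρ : G →* Matrix (Fin N) (Fin N) ℂ)

/-! ## §1 The Mayer sum of a non-facing pair has no short polymers -/

/-- **The Mayer sum of a non-facing pair is `O(γ⁵)`.**  With `ΔΔ = Δφ(hol_P) Δφ(hol_{P'})`, `P = (a;1,2)`,
`P' = (a';1,2)`, `a' 0 = a 0 + 1`, `a' ≠ a + e₀`, and `γ = 2B|b|e^{2B|b|} ≤ 1`:
`|∑_Q ∫ ΔΔ ∏_{q∈Q} g_q| ≤ #𝒫(plaquettes) · (2C_φ)² · γ⁵` — every polymer with at most four plaquettes leaves a bond of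
`P` or of `P'` uncovered (part 13) and is killed by peeling (part 5). -/
theorem mayer_sum_offdiag (hρ : Continuous ρ) (hL : 3 ≤ L) (a a' : Site 4 L) (ha' : a' 0 = a 0 + 1)
    (hne : a' ≠ a.shift 0) {φ : G → ℝ} (hφc : Continuous φ) {Cφ : ℝ}
    (hCφ : ∀ g, |φ g| ≤ Cφ) {B : ℝ} (hB : ∀ (U : GaugeConfig 4 L G) (p : Plaquette 4 L), |plaquetteCost ρ U p| ≤ B)
    (b : ℝ) (hγ : 2 * B * |b| * Real.exp (2 * B * |b|) ≤ 1) :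
    |∑ Q ∈ (Finset.univ : Finset (Plaquette 4 L)).powerset,
        ∫ W, (φ (plaquetteHolonomy (fun e => W (Sum.inl e)) a 1 2) - φ (plaquetteHolonomy (fun e => W (Sum.inr e)) a 1 2)) *
          (φ (plaquetteHolonomy (fun e => W (Sum.inl e)) a' 1 2) -
            φ (plaquetteHolonomy (fun e => W (Sum.inr e)) a' 1 2)) *
          ∏ q ∈ Q, (Real.exp (-(b * dTerm ρ q W)) - 1) ∂(Measure.pi fun _ : Edge 4 L ⊕ Edge 4 L => haarProbability G)| ≤
      ((Finset.univ : Finset (Plaquette 4 L)).powerset.card : ℝ) * ((2 * Cφ) * (2 * Cφ)) *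
        (2 * B * |b| * Real.exp (2 * B * |b|)) ^ 5 := by
  classical
  set μ₂ : Measure (Edge 4 L ⊕ Edge 4 L → G) := Measure.pi fun _ => haarProbability G with hμ₂
  set γ : ℝ := 2 * B * |b| * Real.exp (2 * B * |b|) with hγdef
  have hγ0 : 0 ≤ γ := by
    have : 0 ≤ B := (abs_nonneg _).trans (hB (fun _ => 1) ((0 : Site 4 L), ⟨((0 : Fin 4), (1 : Fin 4)), by decide⟩))
    positivity
  set ΔΔ : (Edge 4 L ⊕ Edge 4 L → G) → ℝ := fun W =>
    (φ (plaquetteHolonomy (fun e => W (Sum.inl e)) a 1 2) - φ (plaquetteHolonomy (fun e => W (Sum.inr e)) a 1 2)) *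
      (φ (plaquetteHolonomy (fun e => W (Sum.inl e)) a' 1 2) - φ (plaquetteHolonomy (fun e => W (Sum.inr e)) a' 1 2))
    with hΔΔ
  set T : Finset (Plaquette 4 L) → ℝ := fun Q => ∫ W, ΔΔ W * ∏ q ∈ Q, (Real.exp (-(b * dTerm ρ q W)) - 1) ∂μ₂ with hT
  have hC0 : 0 ≤ Cφ := (abs_nonneg _).trans (hCφ 1)
  have hd : ∀ h h' : G, |φ h - φ h'| ≤ 2 * Cφ := fun h h' => (abs_sub _ _).trans (by linarith [hCφ h, hCφ h'])
  have hΔΔb : ∀ W, |ΔΔ W| ≤ (2 * Cφ) * (2 * Cφ) := fun W => by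
    simp only [hΔΔ, abs_mul]; exact mul_le_mul (hd _ _) (hd _ _) (abs_nonneg _) (by positivity)
  have hTb : ∀ Q, |T Q| ≤ (2 * Cφ) * (2 * Cφ) * γ ^ Q.card := fun Q => abs_mayer_term_le ρ hB b Q hΔΔb
  -- the two plaquettes lie in different time slices, so they share no bond
  have h1 : (1 : ZMod L) ≠ 0 := one_ne_zero
  have hPP' : ∀ {e : Edge 4 L}, e ∈ ({(a, (1 : Fin 4)), (a.shift 1, (2 : Fin 4)), (a.shift 2, (1 : Fin 4)), (a, (2 : Fin 4))} :
        Finset (Edge 4 L)) → e ∉ ({(a', (1 : Fin 4)), (a'.shift 1, (2 : Fin 4)), (a'.shift 2, (1 : Fin 4)), (a', (2 : Fin 4))} :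
        Finset (Edge 4 L)) := by
    intro e he he'
    have h0 := (bondP_cases a he).1
    have h0' := (bondP_cases a' he').1
    rw [h0, ha'] at h0'
    exact absurd h0' (by simp [h1])
  -- short polymers are killed by peeling
  have hvan : ∀ Q, Q.card ≤ 4 → T Q = 0 := by
    intro Q hcard
    by_cases h0 : ∀ e ∈ ({(a, (1 : Fin 4)), (a.shift 1, (2 : Fin 4)), (a.shift 2, (1 : Fin 4)), (a, (2 : Fin 4))} :
        Finset (Edge 4 L)), ∃ q ∈ Q, q ≠ (a, ⟨((1 : Fin 4), (2 : Fin 4)), by decide⟩) ∧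
        e ∈ ({(q.1, q.2.1.1), (q.1.shift q.2.1.1, q.2.1.2), (q.1.shift q.2.1.2, q.2.1.1), (q.1, q.2.1.2)} :
          Finset (Edge 4 L))
    · by_cases h1' : ∀ e ∈ ({(a', (1 : Fin 4)), (a'.shift 1, (2 : Fin 4)), (a'.shift 2, (1 : Fin 4)), (a', (2 : Fin 4))} :
          Finset (Edge 4 L)), ∃ q ∈ Q, q ≠ (a', ⟨((1 : Fin 4), (2 : Fin 4)), by decide⟩) ∧
          e ∈ ({(q.1, q.2.1.1), (q.1.shift q.2.1.1, q.2.1.2), (q.1.shift q.2.1.2, q.2.1.1), (q.1, q.2.1.2)} :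
            Finset (Edge 4 L))
      · exact absurd (no_short_covering_offdiag hL a a' ha' hne hcard h0 h1') not_false
      · push Not at h1'
        obtain ⟨e, he, hQe⟩ := h1'
        have he' : e ∉ ({(a, (1 : Fin 4)), (a.shift 1, (2 : Fin 4)), (a.shift 2, (1 : Fin 4)), (a, (2 : Fin 4))} :
            Finset (Edge 4 L)) := fun h => hPP' h he
        have h := mayer_term_eq_zero ρ hρ hφc a' a b Q he he' hQe
        simp only [hT, hΔΔ]
        rw [← h]
        exact integral_congr_ae (Eventually.of_forall fun W => by ring)
    · push Not at h0
      obtain ⟨e, he, hQe⟩ := h0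
      exact mayer_term_eq_zero ρ hρ hφc a a' b Q he (hPP' he) hQe
  change |∑ Q ∈ (Finset.univ : Finset (Plaquette 4 L)).powerset, T Q| ≤ _
  refine (Finset.abs_sum_le_sum_abs _ _).trans ?_
  have hterm : ∀ Q ∈ (Finset.univ : Finset (Plaquette 4 L)).powerset, |T Q| ≤ (2 * Cφ) * (2 * Cφ) * γ ^ 5 := by
    intro Q _
    by_cases hc : Q.card ≤ 4
    · rw [hvan Q hc, abs_zero]; positivity
    · push Not at hc
      exact (hTb Q).trans (mul_le_mul_of_nonneg_left (pow_le_pow_of_le_one hγ0 hγ hc) (by positivity))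
  calc ∑ Q ∈ (Finset.univ : Finset (Plaquette 4 L)).powerset, |T Q|
      ≤ ∑ _Q ∈ (Finset.univ : Finset (Plaquette 4 L)).powerset, (2 * Cφ) * (2 * Cφ) * γ ^ 5 := Finset.sum_le_sum hterm
    _ = _ := by rw [Finset.sum_const, nsmul_eq_mul]; ring

/-! ## §2 The covariance of a non-facing pair is `O(b⁵)` on each torus -/

/-- **Non-facing plaquettes in adjacent time slices: `Cov = O(b⁵)` on the torus.**  For `P = (a;1,2)`,
`P' = (a';1,2)` with `a' 0 = a 0 + 1`, `a' ≠ a + e₀` (`L ≥ 3`) there are `K` and `b₁ > 0` with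
`|Cov_{wilsonMeasure ρ b}(Re tr ρ(U_P), Re tr ρ(U_{P'}))| ≤ K |b|⁵` for `|b| ≤ b₁`. -/
theorem torus_cov_offdiag_estimate (hρ : Continuous ρ) (hL : 3 ≤ L) (a a' : Site 4 L) (ha' : a' 0 = a 0 + 1)
    (hne : a' ≠ a.shift 0) :
    ∃ K b₁ : ℝ, 0 < b₁ ∧ ∀ b : ℝ, |b| ≤ b₁ →
      |(∫ U, (ρ (plaquetteHolonomy U a 1 2)).trace.re * (ρ (plaquetteHolonomy U a' 1 2)).trace.re
            ∂(wilsonMeasure (d := 4) (L := L) ρ b)) -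
          (∫ U, (ρ (plaquetteHolonomy U a 1 2)).trace.re ∂(wilsonMeasure (d := 4) (L := L) ρ b)) *
            ∫ U, (ρ (plaquetteHolonomy U a' 1 2)).trace.re ∂(wilsonMeasure (d := 4) (L := L) ρ b)| ≤ K * |b| ^ 5 := by
  classical
  -- the centred class function
  set m₀ : ℝ := ∫ h, (ρ h).trace.re ∂haarProbability G with hm₀
  set φ : G → ℝ := fun g => (ρ g).trace.re - m₀ with hφ
  have hφc : Continuous φ := (continuous_trace_re ρ hρ).sub continuous_const
  have hφm : Measurable φ := hφc.measurable
  obtain ⟨Cφ, hCφ⟩ := isCompact_univ.exists_bound_of_continuousOn hφc.continuousOn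
  have hCφ' : ∀ g, |φ g| ≤ Cφ := fun g => Real.norm_eq_abs _ ▸ hCφ g (Set.mem_univ g)
  have hC0 : 0 ≤ Cφ := (abs_nonneg _).trans (hCφ' 1)
  -- constants
  obtain ⟨B, hB0, hB⟩ := exists_bound_plaquetteCost (L := L) ρ hρ
  obtain ⟨Smax, hSmax⟩ := exists_abs_wilsonAction_le (d := 4) (L := L) ρ hρ
  have hSmax0 : 0 ≤ Smax := (abs_nonneg _).trans (hSmax fun _ => 1)
  set nP : ℝ := ((Finset.univ : Finset (Plaquette 4 L)).powerset.card : ℝ) with hnP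
  set σ2 : ℝ := (2 * Cφ) * (2 * Cφ) with hσ2
  refine ⟨4 * (nP * σ2 * (4 * B) ^ 5 / 2), min (1 / (4 * B + 1)) (1 / (4 * Smax + 1)), by positivity,
    fun b hb => ?_⟩
  have hbB : 4 * B * |b| ≤ 1 := by
    have h := hb.trans (min_le_left _ _)
    rw [le_div_iff₀ (by positivity)] at h; nlinarith [abs_nonneg b]
  have hbS : 4 * Smax * |b| ≤ 1 := by
    have h := hb.trans (min_le_right _ _)
    rw [le_div_iff₀ (by positivity)] at h; nlinarith [abs_nonneg b]
  -- the Mayer parameter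
  set γ : ℝ := 2 * B * |b| * Real.exp (2 * B * |b|) with hγ
  have hγ0 : 0 ≤ γ := by positivity
  have he2 : Real.exp (2 * B * |b|) ≤ 2 := by
    calc Real.exp (2 * B * |b|) ≤ Real.exp (1 / 2) := Real.exp_le_exp.2 (by nlinarith [abs_nonneg b])
      _ ≤ 2 := by
        have h2 : Real.exp (1 / 2) * Real.exp (1 / 2) = Real.exp 1 := by rw [← Real.exp_add]; norm_num
        nlinarith [Real.exp_pos (1 / 2 : ℝ), Real.exp_one_lt_d9]
  have hγle : γ ≤ 4 * B * |b| :=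
    calc γ ≤ 2 * B * |b| * 2 := mul_le_mul_of_nonneg_left he2 (by positivity)
      _ = 4 * B * |b| := by ring
  have hγ1 : γ ≤ 1 := hγle.trans hbB
  ------------------------------------------------------------------ Step 1: centring
  set X₀ : GaugeConfig 4 L G → ℝ := fun U => φ (plaquetteHolonomy U a 1 2) with hX₀
  set X₁ : GaugeConfig 4 L G → ℝ := fun U => φ (plaquetteHolonomy U a' 1 2) with hX₁
  have hX₀m : Measurable X₀ := hφm.comp (measurable_plaquetteHolonomy _ _ _)
  have hX₁m : Measurable X₁ := hφm.comp (measurable_plaquetteHolonomy _ _ _)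
  have hX₀b : ∀ U, |X₀ U| ≤ Cφ := fun U => hCφ' _
  have hX₁b : ∀ U, |X₁ U| ≤ Cφ := fun U => hCφ' _
  haveI := isProbabilityMeasure_wilsonMeasure (d := 4) (L := L) ρ hρ b
  have hI : ∀ {F : GaugeConfig 4 L G → ℝ} {C : ℝ}, Measurable F → (∀ U, |F U| ≤ C) →
      Integrable F (wilsonMeasure (d := 4) (L := L) ρ b) := fun hF hb =>
    Integrable.of_bound hF.aestronglyMeasurable _ (Eventually.of_forall fun U => by rw [Real.norm_eq_abs]; exact hb U)
  have hf0 : (fun U : GaugeConfig 4 L G => (ρ (plaquetteHolonomy U a 1 2)).trace.re) = fun U => X₀ U + m₀ :=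
    funext fun U => by simp only [hX₀, hφ]; ring
  have hf1 : (fun U : GaugeConfig 4 L G => (ρ (plaquetteHolonomy U a' 1 2)).trace.re) = fun U => X₁ U + m₀ :=
    funext fun U => by simp only [hX₁, hφ]; ring
  have hf01 : (fun U : GaugeConfig 4 L G => (ρ (plaquetteHolonomy U a 1 2)).trace.re *
      (ρ (plaquetteHolonomy U a' 1 2)).trace.re) = fun U => (X₀ U + m₀) * (X₁ U + m₀) :=
    funext fun U => by simp only [hX₀, hX₁, hφ]; ring
  rw [hf01, hf0, hf1, cov_add_const (wilsonMeasure (d := 4) (L := L) ρ b) (hI hX₀m hX₀b) (hI hX₁m hX₁b)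
    (hI (hX₀m.mul hX₁m) fun U => by rw [abs_mul]; exact mul_le_mul (hX₀b U) (hX₁b U) (abs_nonneg _) hC0) m₀ m₀]
  ------------------------------------------------------------------ Step 2: doubling and symmetrisation
  have hZpos : 0 < ∫ U, (1 : ℝ) * Real.exp (b * -wilsonAction ρ U) ∂(Measure.pi fun _ : Edge 4 L => haarProbability G) :=
    partition_pos (L := L) ρ hρ b
  have hEm : Measurable fun W : Edge 4 L ⊕ Edge 4 L → G =>
      Real.exp (b * -(wilsonAction ρ (fun e => W (Sum.inl e)) + wilsonAction ρ (fun e => W (Sum.inr e)))) :=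
    ((((measurable_wilsonAction ρ hρ).comp measurable_inl_copy).add
      ((measurable_wilsonAction ρ hρ).comp measurable_inr_copy)).neg.const_mul b).exp
  have hEb : ∀ W : Edge 4 L ⊕ Edge 4 L → G,
      |Real.exp (b * -(wilsonAction ρ (fun e => W (Sum.inl e)) + wilsonAction ρ (fun e => W (Sum.inr e))))| ≤
        Real.exp (|b| * (2 * Smax)) := fun W => by
    rw [Real.abs_exp]
    refine Real.exp_le_exp.2 ((le_abs_self _).trans ?_)
    rw [abs_mul, abs_neg]
    exact mul_le_mul_of_nonneg_left (((abs_add_le _ _).trans (add_le_add (hSmax _) (hSmax _))).trans (le_of_eq (by ring)))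
      (abs_nonneg _)
  have hEs : ∀ W : Edge 4 L ⊕ Edge 4 L → G,
      (fun W : Edge 4 L ⊕ Edge 4 L → G =>
        Real.exp (b * -(wilsonAction ρ (fun e => W (Sum.inl e)) + wilsonAction ρ (fun e => W (Sum.inr e)))))
        (fun i => W (Sum.swap i)) =
      Real.exp (b * -(wilsonAction ρ (fun e => W (Sum.inl e)) + wilsonAction ρ (fun e => W (Sum.inr e)))) :=
    fun W => by simp only [Sum.swap_inl, Sum.swap_inr, add_comm]
  have hdoub := covariance_wilsonMeasure_eq_doubled (L := L) ρ hρ hX₀m hX₁m hX₀b hX₁b b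
  have hsym := doubled_symmetrise (L := L) hX₀m hX₁m hX₀b hX₁b hEm hEb hEs
  have hkey := hdoub.trans hsym
  beta_reduce at hkey
  simp only [hX₀, hX₁] at hkey
  ------------------------------------------------------------------ Step 3: the Mayer expansion under the integral
  have hd0 : ∀ h h' : G, |φ h - φ h'| ≤ 2 * Cφ := fun h h' => (abs_sub _ _).trans (by linarith [hCφ' h, hCφ' h'])
  have hΔΔm : Measurable fun W : Edge 4 L ⊕ Edge 4 L → G => (φ (plaquetteHolonomy (fun e => W (Sum.inl e)) a 1 2) - φ (plaquetteHolonomy (fun e => W (Sum.inr e)) a 1 2)) *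
          (φ (plaquetteHolonomy (fun e => W (Sum.inl e)) a' 1 2) -
            φ (plaquetteHolonomy (fun e => W (Sum.inr e)) a' 1 2)) :=
    (((hφm.comp ((measurable_plaquetteHolonomy _ _ _).comp measurable_inl_copy)).sub
      (hφm.comp ((measurable_plaquetteHolonomy _ _ _).comp measurable_inr_copy))).mul
      ((hφm.comp ((measurable_plaquetteHolonomy _ _ _).comp measurable_inl_copy)).sub
        (hφm.comp ((measurable_plaquetteHolonomy _ _ _).comp measurable_inr_copy))))
  have hΔΔb : ∀ W : Edge 4 L ⊕ Edge 4 L → G, |(φ (plaquetteHolonomy (fun e => W (Sum.inl e)) a 1 2) - φ (plaquetteHolonomy (fun e => W (Sum.inr e)) a 1 2)) *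
          (φ (plaquetteHolonomy (fun e => W (Sum.inl e)) a' 1 2) -
            φ (plaquetteHolonomy (fun e => W (Sum.inr e)) a' 1 2))| ≤ σ2 := fun W => by
    rw [abs_mul, hσ2]; exact mul_le_mul (hd0 _ _) (hd0 _ _) (abs_nonneg _) (by positivity)
  have hσ0 : 0 ≤ σ2 := by positivity
  have hmayer : ∫ W, (φ (plaquetteHolonomy (fun e => W (Sum.inl e)) a 1 2) - φ (plaquetteHolonomy (fun e => W (Sum.inr e)) a 1 2)) *
          (φ (plaquetteHolonomy (fun e => W (Sum.inl e)) a' 1 2) -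
            φ (plaquetteHolonomy (fun e => W (Sum.inr e)) a' 1 2)) * Real.exp (b * -(wilsonAction ρ (fun e => W (Sum.inl e)) + wilsonAction ρ (fun e => W (Sum.inr e)))) ∂(Measure.pi fun _ : Edge 4 L ⊕ Edge 4 L => haarProbability G) =
      ∑ Q ∈ (Finset.univ : Finset (Plaquette 4 L)).powerset,
        ∫ W, (φ (plaquetteHolonomy (fun e => W (Sum.inl e)) a 1 2) - φ (plaquetteHolonomy (fun e => W (Sum.inr e)) a 1 2)) *
          (φ (plaquetteHolonomy (fun e => W (Sum.inl e)) a' 1 2) -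
            φ (plaquetteHolonomy (fun e => W (Sum.inr e)) a' 1 2)) * ∏ q ∈ Q, (Real.exp (-(b * dTerm ρ q W)) - 1) ∂(Measure.pi fun _ : Edge 4 L ⊕ Edge 4 L => haarProbability G) := by
    have hpt : ∀ W : Edge 4 L ⊕ Edge 4 L → G, (φ (plaquetteHolonomy (fun e => W (Sum.inl e)) a 1 2) - φ (plaquetteHolonomy (fun e => W (Sum.inr e)) a 1 2)) *
          (φ (plaquetteHolonomy (fun e => W (Sum.inl e)) a' 1 2) -
            φ (plaquetteHolonomy (fun e => W (Sum.inr e)) a' 1 2)) * Real.exp (b * -(wilsonAction ρ (fun e => W (Sum.inl e)) + wilsonAction ρ (fun e => W (Sum.inr e)))) =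
        ∑ Q ∈ (Finset.univ : Finset (Plaquette 4 L)).powerset, (φ (plaquetteHolonomy (fun e => W (Sum.inl e)) a 1 2) - φ (plaquetteHolonomy (fun e => W (Sum.inr e)) a 1 2)) *
          (φ (plaquetteHolonomy (fun e => W (Sum.inl e)) a' 1 2) -
            φ (plaquetteHolonomy (fun e => W (Sum.inr e)) a' 1 2)) * ∏ q ∈ Q, (Real.exp (-(b * dTerm ρ q W)) - 1) :=
      fun W => by rw [mayer_expansion ρ b W, Finset.mul_sum]
    simp_rw [hpt]
    refine integral_finsetSum _ fun Q _ => ?_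
    exact Integrable.of_bound (hΔΔm.mul (measurable_prod_mayerWeight ρ hρ b Q)).aestronglyMeasurable
      (σ2 * γ ^ Q.card) (Eventually.of_forall fun W => by
        rw [Real.norm_eq_abs, abs_mul]
        exact mul_le_mul (hΔΔb W) (abs_prod_mayerWeight_le ρ hB b Q W) (abs_nonneg _) hσ0)
  ------------------------------------------------------------------ Step 4: no short polymers
  have hred := mayer_sum_offdiag (L := L) ρ hρ hL a a' ha' hne hφc hCφ' hB b hγ1
  ------------------------------------------------------------------ Step 5: the partition function
  have hZ1 : |(∫ U, (1 : ℝ) * Real.exp (b * -wilsonAction ρ U) ∂(Measure.pi fun _ : Edge 4 L => haarProbability G)) - 1| ≤ 2 * |b| * Smax := by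
    have h := abs_partition_sub_one_le (L := L) ρ hρ hSmax b
    have he : Real.exp (|b| * Smax) ≤ 2 :=
      calc Real.exp (|b| * Smax) ≤ Real.exp (1 / 2) := Real.exp_le_exp.2 (by nlinarith only [abs_nonneg b, hbS, hSmax0])
        _ ≤ 2 := by
          have h2 : Real.exp (1 / 2) * Real.exp (1 / 2) = Real.exp 1 := by rw [← Real.exp_add]; norm_num
          nlinarith only [h2, Real.exp_pos (1 / 2 : ℝ), Real.exp_one_lt_d9, Real.add_one_le_exp (1/2 : ℝ)]
    calc |(∫ U, (1 : ℝ) * Real.exp (b * -wilsonAction ρ U) ∂(Measure.pi fun _ : Edge 4 L => haarProbability G)) - 1| ≤ |b| * Smax * Real.exp (|b| * Smax) := h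
      _ ≤ |b| * Smax * 2 := mul_le_mul_of_nonneg_left he (by positivity)
      _ = 2 * |b| * Smax := by ring
  set Z : ℝ := (∫ U, (1 : ℝ) * Real.exp (b * -wilsonAction ρ U) ∂(Measure.pi fun _ : Edge 4 L => haarProbability G)) with hZ
  clear_value Z
  have hZhalf : 1 / 2 ≤ Z := by
    have : Z - 1 ≥ -(2 * |b| * Smax) := (abs_le.1 hZ1).1
    linarith only [this, hbS]
  ------------------------------------------------------------------ Step 6: assembly
  set Cv : ℝ := ((∫ U, X₀ U * X₁ U ∂(wilsonMeasure (d := 4) (L := L) ρ b)) -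
      (∫ U, X₀ U ∂(wilsonMeasure (d := 4) (L := L) ρ b)) * ∫ U, X₁ U ∂(wilsonMeasure (d := 4) (L := L) ρ b)) with hCv
  set Ssum : ℝ := ∑ Q ∈ (Finset.univ : Finset (Plaquette 4 L)).powerset,
    ∫ W, (φ (plaquetteHolonomy (fun e => W (Sum.inl e)) a 1 2) - φ (plaquetteHolonomy (fun e => W (Sum.inr e)) a 1 2)) *
          (φ (plaquetteHolonomy (fun e => W (Sum.inl e)) a' 1 2) -
            φ (plaquetteHolonomy (fun e => W (Sum.inr e)) a' 1 2)) * ∏ q ∈ Q, (Real.exp (-(b * dTerm ρ q W)) - 1) ∂(Measure.pi fun _ : Edge 4 L ⊕ Edge 4 L => haarProbability G) with hSsum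
  have hS : Z ^ 2 * Cv = (1 / 2) * Ssum := by rw [hkey, hmayer]
  clear_value Cv Ssum
  have hγ5 : γ ^ 5 ≤ (4 * B) ^ 5 * |b| ^ 5 := by
    rw [← mul_pow]; exact pow_le_pow_left₀ hγ0 (by linarith only [hγle]) 5
  have hnP0 : 0 ≤ nP := by positivity
  have hnum : |Z ^ 2 * Cv| ≤ (nP * σ2 * (4 * B) ^ 5 / 2) * |b| ^ 5 := by
    rw [hS, abs_mul, abs_of_pos (by norm_num : (0 : ℝ) < 1 / 2)]
    have h2 := mul_le_mul_of_nonneg_left hγ5 (mul_nonneg hnP0 hσ0)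
    linarith only [hred, h2]
  have hZ2pos : 0 < Z ^ 2 := by positivity
  have hZ2lb : 1 / 4 ≤ Z ^ 2 :=
    calc (1 : ℝ) / 4 = (1 / 2) * (1 / 2) := by norm_num
      _ ≤ Z * Z := mul_le_mul hZhalf hZhalf (by norm_num) (by linarith only [hZhalf])
      _ = Z ^ 2 := (sq Z).symm
  change |Cv| ≤ 4 * (nP * σ2 * (4 * B) ^ 5 / 2) * |b| ^ 5
  have hCv' : |Cv| = |Z ^ 2 * Cv| / Z ^ 2 := by
    rw [abs_mul, abs_of_pos hZ2pos, mul_div_cancel_left₀ _ hZ2pos.ne']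
  rw [hCv', div_le_iff₀ hZ2pos]
  have hK2 : 0 ≤ (nP * σ2 * (4 * B) ^ 5 / 2) * |b| ^ 5 := le_trans (abs_nonneg _) hnum
  nlinarith only [mul_nonneg (sub_nonneg.2 hZ2lb) hK2, hK2, hnum]

end Summit.QuantumFields.YangMills.Cruxes.IR.SCFloor

end
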